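import Literature.NumberTheory.EllipticCurves.Sprung2012.LocalTowerNoPTorsionProofs
import Literature.NumberTheory.EllipticCurves.IwasawaSelmerControlLocalInputsProofs
import HarnessLib

/-!
# `E(K_∞·K_v) = ⋃_n E(K_n·K_v)` (Sprung 2012, Lemma 7.10) and the `p`-saturation of `E(K_v)` in
# `E(K_∞·K_v)` at a supersingular prime — proofs

`Proofs` file (theorems only; no definition, no named fact; net Literature debt `0`) in topic
`Literature/NumberTheory/EllipticCurves`, cluster `Sprung2012`, continuing
`Sprung2012/LocalTowerNoPTorsionProofs.lean`. Setting of `Sprung2012/ColemanMaps.lean`: `K` a field,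
`κ` a `ℤ_p`-extension of `K`, a `K`-field `E` (a completion `K_v`) with an embedding
`ι : K̄ → K̄_E`; `E(K_∞·K_v) = localTowerPointsOfEmb κ ι W` (the points of `E(K̄_v)` fixed by
`Gal(K̄_v/K_∞·K_v) = localSubgroupOfEmb κ.kerSubgroup ι`) and the layers
`E(K_n·K_v) = Kobayashi2003.localLayerPointsOfEmb κ ι W n` (fixed by
`Gal(K̄_v/K_n·K_v) = localSubgroupOfEmb (κ.layerSubgroup n) ι`).

1. **`E(K_∞·K_v) = ⋃_n E(K_n·K_v)`** (`exists_mem_localLayerPointsOfEmb_of_mem_localTowerPointsOfEmb`,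
   `localTowerPointsOfEmb_eq_iSup`): the union over which F. Sprung, *J. Number Theory* **132** (2012),
   Lemma 7.10 (p. 1503) is stated ("`E(K_{∞,𝔭}) ⊗ ℚ_p/ℤ_p = lim→_n H¹(K_{n,𝔭_n}, V/T)` … `E(K_{n,𝔭_n}) ⊗ ℤ_p`
   and `E(K_{n,𝔭_n}) ⊗ ℚ_p/ℤ_p` are exact annihilators of each other"; S. Kobayashi, Invent. Math. 152
   (2003), Def. 1.1: "`E(F_{n,p})` … the completion of `F_n` at the place over `p`") — the converse of
   the tree's `localLayerPointsOfEmb_le_localTowerPointsOfEmb`. Proof: the stabiliser of a point of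
   `E(K̄_v)` is OPEN (`WeierstrassCurve.isOpen_stabilizer_localPoints`), the local layer subgroups are
   CLOSED and decrease to `Gal(K̄_v/K_∞·K_v)` (a `σ` in all of them has `pⁿ ∣ κ(res σ)` for every
   `n`, so `κ(res σ) = 0`), and `Γ_{K_v}` is compact (`absoluteGaloisGroup_compactSpace`), so some
   layer subgroup already fixes the point (`IsCompact.elim_directed_family_closed`).
2. **`E(K_v)` is `p`-saturated in `E(K_∞·K_v)` when the latter has no `p`-torsion**
   (`smul_eq_self_of_nsmul_of_noPTorsion`, `mem_localLayerPointsOfEmb_of_pow_nsmul_mem`): if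
   `pᵏ • y` is fixed by an element `σ ∈ Γ_{K_v}` (e.g. `pᵏ • y ∈ E(K_n·K_v)`) then so is `y`, because
   `σ • y − y ∈ E(K_∞·K_v)[pᵏ] = 0` — the step "(`σ − 1`)`y ∈ E(ℚ_{p,m})[p] = 0`" behind Sprung 2012,
   proof of Prop. 7.3 (p. 1500: "`H¹(k_n, T) → H¹(k_m, T)` is surjective if `n ⩾ m` … the formal group
   has no `p`-power torsion in `k_n` by Lemma 2.3") and Sprung 2024, proof of Lemma 5.5 (p. 40:
   "The middle vertical map is a surjection by [64, Lemma 2.3]"); with Lemma 2.3 DISCHARGED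
   (`lem23_localTowerPoints_noPTorsion_holds`, `LocalTowerNoPTorsionProofs`) the `ℚ`-specialisation
   `mem_localLayerPointsOfEmb_of_pow_nsmul_mem_rat` is unconditional at a good supersingular `p ≠ 2`.

HONEST FRAMING: Galois bookkeeping on local points; nothing about any census cell; BSD is not proved
by any of this (cell `pub/bsd-cited`, seat `bsd-cited-r18`, base-role infrastructure for the
discharge road of Sprung 2012 Props. 7.3/7.6).

## References
* [Sprung2012] F. Sprung, J. Number Theory 132 (2012), §1 p. 1486 (`k_∞ = ⋃ k_n`), Lemma 7.10
  (p. 1503), proof of Prop. 7.3 (pp. 1500–1501).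
* [Kobayashi2003] S. Kobayashi, Invent. Math. 152 (2003), Def. 1.1.
* [Sprung2024] F. Sprung, Adv. Math. 449 (2024) 109741, §5.2 proof of Lemma 5.5 (p. 40).
-/

noncomputable section

open scoped Classical

open WeierstrassCurve Literature.NumberTheory.EllipticCurves
  Literature.NumberTheory.EllipticCurves.ZpExtension Literature.NumberTheory.EllipticCurves.Kobayashi2003

universe u

namespace Literature.NumberTheory.EllipticCurves.Sprung2012

section Union

variable {K : Type u} [Field K] {p : ℕ} [Fact p.Prime] (κ : ZpExtension K p)
  {E : Type u} [Field E] [Algebra K E] (ι : AlgebraicClosure K →ₐ[K] AlgebraicClosure E)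
  (W : WeierstrassCurve K)

/-- An element of `ℤ_p` divisible by every power of `p` is `0`. [folklore] -/
private theorem padicInt_eq_zero_of_forall_pow_dvd {x : ℤ_[p]} (h : ∀ n : ℕ, (p : ℤ_[p]) ^ n ∣ x) :
    x = 0 := by
  have hp : p.Prime := Fact.out
  by_contra hx
  have hpos : 0 < ‖x‖ := norm_pos_iff.mpr hx
  obtain ⟨k, hk⟩ := PadicInt.exists_pow_neg_lt p hpos
  have hle : ‖x‖ ≤ (p : ℝ) ^ (-(k : ℤ)) :=
    (PadicInt.norm_le_pow_iff_mem_span_pow x k).mpr (Ideal.mem_span_singleton.mpr (h k))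
  exact absurd (lt_of_lt_of_le hk hle) (lt_irrefl _)

/-- The local layer subgroups `Gal(K̄_v/K_n·K_v)` are closed in `Γ_{K_v}` (preimages of the open,
hence closed, subgroups `κ⁻¹(pⁿℤ_p)` under the continuous restriction). [folklore] -/
private theorem isClosed_localLayerSubgroupOfEmb (n : ℕ) :
    IsClosed (localLayerSubgroupOfEmb κ ι n : Set (Field.absoluteGaloisGroup E)) := by
  have h : IsClosed (κ.layerSubgroup n : Set (Field.absoluteGaloisGroup K)) :=
    Subgroup.isClosed_of_isOpen _ (κ.isOpen_layerSubgroup n)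
  exact h.preimage (map_continuous (resGalOfEmb ι))

/-- A `σ ∈ Γ_{K_v}` lying in every local layer subgroup lies in `Gal(K̄_v/K_∞·K_v)`
(`⋂_n κ⁻¹(pⁿℤ_p) = ker κ`). [folklore] -/
private theorem mem_localSubgroupOfEmb_kerSubgroup_of_forall {σ : Field.absoluteGaloisGroup E}
    (h : ∀ n, σ ∈ localLayerSubgroupOfEmb κ ι n) : σ ∈ localSubgroupOfEmb κ.kerSubgroup ι := by
  rw [mem_localSubgroupOfEmb_iff, mem_kerSubgroup]
  have h0 : (κ (resGalOfEmb ι σ)).toAdd = 0 :=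
    padicInt_eq_zero_of_forall_pow_dvd fun n ↦ (mem_localLayerSubgroupOfEmb_iff κ ι n σ).mp (h n)
  exact Multiplicative.toAdd.injective (by rw [h0, toAdd_one])

/-- **`E(K_∞·K_v) = ⋃_n E(K_n·K_v)`**: every point of `E(K̄_v)` fixed by `Gal(K̄_v/K_∞·K_v)` is
already fixed by `Gal(K̄_v/K_n·K_v)` for some `n` — the union in which Sprung's `E(K_{∞,𝔭})`
(Lemma 7.10) and Kobayashi's `E(F_{∞,p})` (Def. 1.1) are meant; converse of
`localLayerPointsOfEmb_le_localTowerPointsOfEmb`. Proof: the stabiliser of the point is open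
(`isOpen_stabilizer_localPoints`), the layer subgroups are closed and decrease to
`Gal(K̄_v/K_∞·K_v)`, and `Γ_{K_v}` is compact, so one of them lies inside the stabiliser
(`IsCompact.elim_directed_family_closed`). [cite: Sprung2012, Lemma 7.10 (p. 1503)]
[cite: Kobayashi2003, Def. 1.1] -/
theorem exists_mem_localLayerPointsOfEmb_of_mem_localTowerPointsOfEmb {P : localPoints W E}
    (hP : P ∈ localTowerPointsOfEmb κ ι W) : ∃ n, P ∈ localLayerPointsOfEmb κ ι W n := by
  haveI : CompactSpace (Field.absoluteGaloisGroup E) :=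
    Literature.NumberTheory.GaloisRepresentations.absoluteGaloisGroup_compactSpace E
  -- the open stabiliser `U` of `P` and the closed sets `t n = Gal(K̄_v/K_n·K_v) \ U`
  set U : Set (Field.absoluteGaloisGroup E) :=
    (MulAction.stabilizer (Field.absoluteGaloisGroup E) P : Set (Field.absoluteGaloisGroup E)) with hU
  have hUo : IsOpen U := WeierstrassCurve.isOpen_stabilizer_localPoints W E P
  let t : ℕ → Set (Field.absoluteGaloisGroup E) := fun n ↦
    (localLayerSubgroupOfEmb κ ι n : Set (Field.absoluteGaloisGroup E)) ∩ Uᶜ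
  have htc : ∀ n, IsClosed (t n) := fun n ↦
    (isClosed_localLayerSubgroupOfEmb κ ι n).inter hUo.isClosed_compl
  have hanti : Antitone t := fun m n hmn σ hσ ↦
    ⟨localLayerSubgroupOfEmb_antitone κ ι hmn hσ.1, hσ.2⟩
  have hdt : Directed (· ⊇ ·) t := hanti.directed_ge
  -- their intersection is empty: a `σ` in all layer subgroups lies in `Gal(K̄_v/K_∞·K_v) ⊆ U`
  have hst : (Set.univ ∩ ⋂ n, t n) = ∅ := by
    rw [Set.univ_inter, Set.eq_empty_iff_forall_notMem]
    intro σ hσ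
    rw [Set.mem_iInter] at hσ
    have hmem : σ ∈ localSubgroupOfEmb κ.kerSubgroup ι :=
      mem_localSubgroupOfEmb_kerSubgroup_of_forall κ ι fun n ↦ (hσ n).1
    have hfix : σ • P = P := (mem_localTowerPointsOfEmb_iff κ ι W P).mp hP σ hmem
    exact (hσ 0).2 (by rw [hU]; exact MulAction.mem_stabilizer_iff.mpr hfix)
  obtain ⟨n, hn⟩ := isCompact_univ.elim_directed_family_closed t htc hst hdt
  refine ⟨n, (mem_localLayerPointsOfEmb_iff κ ι W n P).mpr fun τ hτ ↦ ?_⟩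
  -- `Gal(K̄_v/K_n·K_v) ⊆ U`
  by_contra hne
  have hτt : τ ∈ t n := ⟨hτ, fun hτU ↦ hne (MulAction.mem_stabilizer_iff.mp hτU)⟩
  have : τ ∈ (Set.univ ∩ t n) := ⟨Set.mem_univ _, hτt⟩
  rw [hn] at this
  exact this

/-- **`E(K_∞·K_v) = ⨆_n E(K_n·K_v)`** as subgroups of `E(K̄_v)`. [cite: Sprung2012, Lemma 7.10 (p. 1503)] -/
theorem localTowerPointsOfEmb_eq_iSup :
    localTowerPointsOfEmb κ ι W = ⨆ n, localLayerPointsOfEmb κ ι W n := by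
  refine le_antisymm (fun P hP ↦ ?_) (iSup_le fun n ↦ localLayerPointsOfEmb_le_localTowerPointsOfEmb κ ι W n)
  obtain ⟨n, hn⟩ := exists_mem_localLayerPointsOfEmb_of_mem_localTowerPointsOfEmb κ ι W hP
  exact AddSubgroup.mem_iSup_of_mem n hn

/-- Two points of the tower lie in a common layer. [cite: Sprung2012, Lemma 7.10 (p. 1503)] -/
theorem exists_mem_localLayerPointsOfEmb_pair {P Q : localPoints W E}
    (hP : P ∈ localTowerPointsOfEmb κ ι W) (hQ : Q ∈ localTowerPointsOfEmb κ ι W) :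
    ∃ n, P ∈ localLayerPointsOfEmb κ ι W n ∧ Q ∈ localLayerPointsOfEmb κ ι W n := by
  obtain ⟨m, hm⟩ := exists_mem_localLayerPointsOfEmb_of_mem_localTowerPointsOfEmb κ ι W hP
  obtain ⟨n, hn⟩ := exists_mem_localLayerPointsOfEmb_of_mem_localTowerPointsOfEmb κ ι W hQ
  exact ⟨max m n, localLayerPointsOfEmb_mono κ ι W (le_max_left m n) hm,
    localLayerPointsOfEmb_mono κ ι W (le_max_right m n) hn⟩

end Union

/-! ## `E(K_v)` (and every layer) is `p`-saturated in `E(K_∞·K_v)` when the tower has no `p`-torsion -/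

section Saturation

variable {K : Type u} [Field K] {p : ℕ} [Fact p.Prime] (κ : ZpExtension K p)
  {E : Type u} [Field E] [Algebra K E] (ι : AlgebraicClosure K →ₐ[K] AlgebraicClosure E)
  (W : WeierstrassCurve K)

/-- No `p`-torsion in `E(K_∞·K_v)` ⟹ no `pᵏ`-torsion there (the form «no p-power torsion in
k_n» in which Lemma 2.3 is used on p. 1501). [cite: Sprung2012, Lemma 2.3 (p. 1487) and p. 1501 ("no p-power torsion in k_n by Lemma 2.3")] -/
theorem eq_zero_of_pow_nsmul_eq_zero_of_noPTorsion
    (hnt : ∀ P ∈ localTowerPointsOfEmb κ ι W, p • P = 0 → P = 0)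
    {k : ℕ} {P : localPoints W E} (hP : P ∈ localTowerPointsOfEmb κ ι W) (h : p ^ k • P = 0) :
    P = 0 := by
  induction k generalizing P with
  | zero => rwa [pow_zero, one_smul] at h
  | succ k ih =>
    have h1 : p ^ k • P ∈ localTowerPointsOfEmb κ ι W := AddSubgroup.nsmul_mem _ hP _
    have h2 : p • (p ^ k • P) = 0 := by rw [← mul_smul, ← pow_succ']; exact h
    exact ih hP (hnt _ h1 h2)

/-- **An element of `Γ_{K_v}` fixing `pᵏ • y` fixes `y`** (`y ∈ E(K_∞·K_v)`, no `p`-torsion in the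
tower): `σ • y − y` lies in the tower (which is `Γ_{K_v}`-stable) and is killed by `pᵏ`. This is the
step "(`σ − 1`)`y ∈ E(k_m)[p^∞] = 0`" of Sprung 2012, proof of Prop. 7.3 (surjectivity of the
corestriction, pp. 1500–1501) and of Sprung 2024, p. 40 ("[64, Lemma 2.3]").
[cite: Sprung2012, proof of Prop. 7.3 (pp. 1500–1501)] [cite: Sprung2024, §5.2 proof of Lemma 5.5 (p. 40)] -/
theorem smul_eq_self_of_pow_nsmul_of_noPTorsion
    (hnt : ∀ P ∈ localTowerPointsOfEmb κ ι W, p • P = 0 → P = 0)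
    {k : ℕ} {y : localPoints W E} (hy : y ∈ localTowerPointsOfEmb κ ι W)
    (σ : Field.absoluteGaloisGroup E) (hσ : σ • (p ^ k • y) = p ^ k • y) : σ • y = y := by
  have hmem : σ • y - y ∈ localTowerPointsOfEmb κ ι W :=
    sub_mem (smul_mem_localTowerPointsOfEmb κ ι W σ hy) hy
  have hkill : p ^ k • (σ • y - y) = 0 := by
    rw [smul_sub, smul_comm, hσ, sub_self]
  exact sub_eq_zero.mp (eq_zero_of_pow_nsmul_eq_zero_of_noPTorsion κ ι W hnt hmem hkill)

/-- **`E(K_n·K_v)` is `p`-saturated in `E(K_∞·K_v)`** (no `p`-torsion in the tower): if `pᵏ • y`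
lies in the `n`-th layer then so does `y`; with `n = 0`, `E(K_v)` is `p`-saturated in `E(K_∞·K_v)`.
[cite: Sprung2012, proof of Prop. 7.3 (pp. 1500–1501)] -/
theorem mem_localLayerPointsOfEmb_of_pow_nsmul_mem
    (hnt : ∀ P ∈ localTowerPointsOfEmb κ ι W, p • P = 0 → P = 0)
    {k n : ℕ} {y : localPoints W E} (hy : y ∈ localTowerPointsOfEmb κ ι W)
    (hky : p ^ k • y ∈ localLayerPointsOfEmb κ ι W n) : y ∈ localLayerPointsOfEmb κ ι W n := by
  rw [mem_localLayerPointsOfEmb_iff] at hky ⊢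
  exact fun τ hτ ↦ smul_eq_self_of_pow_nsmul_of_noPTorsion κ ι W hnt hy τ (hky τ hτ)

end Saturation

/-! ## The `ℚ`-specialisation: unconditional at a good supersingular `p ≠ 2` (Lemma 2.3 discharged) -/

section Rat

open NumberField IsDedekindDomain

variable (W : WeierstrassCurve ℚ) [W.IsElliptic] [W.IsGloballyMinimal] (p : ℕ) [Fact p.Prime]
  {v : HeightOneSpectrum (𝓞 ℚ)}

/-- **`E(ℚ_{p,n})` is `p`-saturated in `E(ℚ_∞·ℚ_p)`** for `W/ℚ` elliptic globally minimal, `p ≠ 2` of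
good supersingular reduction, any `ℤ_p`-extension `κ` of `ℚ` and any embedding `ι : ℚ̄ → K̄_v`
(`v ∋ p`): `pᵏ • y ∈ E(ℚ_{p,n})`, `y ∈ E(ℚ_∞·ℚ_p)` ⟹ `y ∈ E(ℚ_{p,n})` — unconditional by the
discharge of Lemma 2.3 (`eq_zero_of_mem_localTowerPointsOfEmb_of_prime_nsmul`).
[cite: Sprung2012, Lemma 2.3 (p. 1487) and proof of Prop. 7.3 (pp. 1500–1501)] -/
theorem mem_localLayerPointsOfEmb_of_pow_nsmul_mem_rat (hp2 : p ≠ 2)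
    (hgood : W.HasGoodReductionAtPrime p) (hap : (p : ℤ) ∣ W.frobeniusTrace p)
    (κ : ZpExtension ℚ p) (hpv : (p : 𝓞 ℚ) ∈ v.asIdeal)
    (ι : AlgebraicClosure ℚ →ₐ[ℚ] AlgebraicClosure (v.adicCompletion ℚ))
    {k n : ℕ} {y : localPoints W (v.adicCompletion ℚ)} (hy : y ∈ localTowerPointsOfEmb κ ι W)
    (hky : p ^ k • y ∈ localLayerPointsOfEmb κ ι W n) : y ∈ localLayerPointsOfEmb κ ι W n :=
  mem_localLayerPointsOfEmb_of_pow_nsmul_mem κ ι W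
    (fun _ hP hpP ↦ eq_zero_of_mem_localTowerPointsOfEmb_of_prime_nsmul W p hp2 hgood hap κ hpv ι hP hpP)
    hy hky

end Rat

end Literature.NumberTheory.EllipticCurves.Sprung2012

end
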